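import Summits.QuantumFields.YangMills.Theorems.ParabolicTrajectoryContinuumLimitOnTrajectoryDefsE

/-!
# Route `OneCertifiedCube`, crux `ContinuumLimitExists` (stmt-QuantumFields-16124): vocabulary of line `birth` — gap-free input statements

Route-posited objects (D-0016 `<Route><Crux>Defs` file) of the line lead `prover-line-stmt-QuantumFields-16124-0`
(skeleton `Cruxes/ContinuumLimitExists/Lines/birth.lean`, namespace `Summit.QuantumFields.YangMills.Cruxes.ContinuumLimitExists.Birth`).
NOTHING here is asserted: every `def … : Prop` is a line statement that a registered stub proves or a supplier reduction consumes
(none is a literature fact, none restates the crux). The crux is the gap-free EXISTENCE leg of the summit clause; the sibling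
crux `ContinuumLimitOnTrajectory` (route ParabolicTrajectory) states its two open physics inputs `IRPhysicsCS` / `UVPhysics345`
(`…ContinuumLimitOnTrajectoryDefsE`) with the antecedents `0 < Δ`, `HasLatticeMassGap r sch Δ`, which its own leads found IDLE
(consumed by no proved step; `Cruxes/ContinuumLimitOnTrajectory/LEAD-SUMMARY.md` §2). This file carries the GAP-FREE TWINS, so
that ONE proof serves both routes:
* `QualFiniteSizeInput` — the rate-free thermodynamic limit at scale (`QualFiniteSize`) along tuned weak-coupling `M`-adic Wilson
  sequences with polynomial volume growth (twin of `IRPhysicsCS`'s first conjunct);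
* `UVEngine345` — the volume-uniform UV engine `UUVB ∧ Rot345 ∧ ND2 ∧ ND3` along the same sequences given `ConvProducts` (twin of
  `UVPhysics345`; `uvPhysics345_of_uvEngine345`);
* `UVScheme345` — the line's ∃-stub `stub_uvScheme` with the one-rotation restoration `Rot345` added: the common OUTPUT shape of
  any constructive supplier (reached from (S_PVG) + `ChartExists` + the two twins by the supplier reduction
  `uvScheme345_of_twoOrbit`, crux workfile `Cruxes/ContinuumLimitExists/UvSchemeOfTwoOrbit.lean`).
Refs: `…ContinuumLimitOnTrajectoryDefs{,C,E,G}`; Balaban1988Convergent; OsterwalderSeiler1978 §§2–4.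
-/

set_option autoImplicit false

open scoped SchwartzMap
open MeasureTheory Filter Topology
open Literature.MathematicalPhysics.QuantumFieldTheory Literature.MathematicalPhysics.QuantumLattice
open Literature.MathematicalPhysics.AQFT Literature.Probability.LatticeModels
open Summit.QuantumFields.YangMills.Cruxes.ContinuumLimitOnTrajectory.TwoOrbitSynchronisation

noncomputable section

namespace Summit.QuantumFields.YangMills.Cruxes.ContinuumLimitExists.Birth

/-- **`QualFiniteSizeInput` — the rate-free thermodynamic limit at scale, GAP-FREE** (twin of the first conjunct of the sibling
input `IRPhysicsCS`, `…DefsE`, with the idle antecedents `0 < Δ`, `HasLatticeMassGap r sch Δ` deleted): along every tuned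
`M`-adic weak-coupling Wilson sequence with convergent towers and polynomial volume growth, `QualFiniteSize r M sch n`
(`…DefsC`: the canonical `p`-point functions on the scheme's torus agree up to `o(1)`, uniformly over all larger tori, with the
unit-normalised block-dilated Wilson functions; same for the scaled point-split correlators). IR physics; open. -/
def QualFiniteSizeInput : Prop :=
  ∀ (G : Type) [Group G] [TopologicalSpace G] [IsTopologicalGroup G] [CompactSpace G]
    [MeasurableSpace G] [BorelSpace G], IsCompactSimpleLieGroup G →
    ∀ (r : LatticeRep G) (M : ℕ) (θ : ℝ) (sch : SpeciesScheme (YMSpecies G)) (n : ℕ → ℕ),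
    0 < θ → (∀ k, sch.a k = ((M : ℝ) ^ n k)⁻¹) → Tendsto sch.β atTop atTop →
    (∀ t : ℕ, 0 < t → ∃ c : ℝ, Tendsto (fun k => ((M : ℝ) ^ n k) ^ 8 *
      latticeConnectedCorr r.ρ (sch.β k) (sch.side k) r.curvature.F r.curvature.F (t * M ^ n k)) atTop (𝓝 c)) →
    Tendsto (fun k => ((M : ℝ) ^ n k) ^ 8 *
      latticeConnectedCorr r.ρ (sch.β k) (sch.side k) r.curvature.F r.curvature.F (M ^ n k)) atTop (𝓝 θ) →
    PolyVolumeGrowth sch → QualFiniteSize r M sch n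

/-- **`UVEngine345` — the volume-uniform UV engine, GAP-FREE** (twin of the sibling input `UVPhysics345`, `…DefsE`, with the
idle antecedents `0 < Δ`, `HasLatticeMassGap r sch Δ` deleted): along every tuned `M`-adic weak-coupling Wilson sequence with
convergent towers, polynomial volume growth and product-convergent canonical curvature functions: uniform-threshold
plaquette-string bounds `UUVB`, asymptotic invariance under ONE Pythagorean rotation `Rot345`, and the non-degeneracy
witnesses `ND2`, `ND3`. UV physics (Bałaban / Magnen–Rivasseau–Sénéor class, with observables); open. -/
def UVEngine345 : Prop :=
  ∀ (G : Type) [Group G] [TopologicalSpace G] [IsTopologicalGroup G] [CompactSpace G]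
    [MeasurableSpace G] [BorelSpace G], IsCompactSimpleLieGroup G →
    ∀ (r : LatticeRep G) (M : ℕ) (θ : ℝ) (sch : SpeciesScheme (YMSpecies G)) (n : ℕ → ℕ),
    0 < θ → (∀ k, sch.a k = ((M : ℝ) ^ n k)⁻¹) → Tendsto sch.β atTop atTop →
    (∀ t : ℕ, 0 < t → ∃ c : ℝ, Tendsto (fun k => ((M : ℝ) ^ n k) ^ 8 *
      latticeConnectedCorr r.ρ (sch.β k) (sch.side k) r.curvature.F r.curvature.F (t * M ^ n k)) atTop (𝓝 c)) →
    Tendsto (fun k => ((M : ℝ) ^ n k) ^ 8 *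
      latticeConnectedCorr r.ρ (sch.β k) (sch.side k) r.curvature.F r.curvature.F (M ^ n k)) atTop (𝓝 θ) →
    PolyVolumeGrowth sch → ConvProducts r sch →
      UUVB r sch ∧ Rot345 r sch ∧ ND2 r sch ∧ ND3 r sch

/-- **`UVScheme345` — the ∃-stub `stub_uvScheme` with the one-rotation restoration added** (the form every supplier that
delivers a UV package of `UVPhysics345` type reaches): for every compact simple `G`, a faithful lattice representation and a
weak-coupling, polynomially growing scheme with `ConvProducts`, `UUVB`, `Rot345`, `ND2`, `ND3`. -/
def UVScheme345 : Prop :=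
  ∀ (G : Type) [Group G] [TopologicalSpace G] [IsTopologicalGroup G] [CompactSpace G]
    [MeasurableSpace G] [BorelSpace G], IsCompactSimpleLieGroup G →
    ∃ (r : LatticeRep G) (sch : SpeciesScheme (YMSpecies G)),
      sch.HasWeakCouplingLimit ∧ PolyVolumeGrowth sch ∧ ConvProducts r sch ∧ UUVB r sch ∧ Rot345 r sch ∧
        ND2 r sch ∧ ND3 r sch

/-- The gap-free UV twin implies the sibling's gapped input `UVPhysics345` (ignore the gap antecedents): one proof of
`UVEngine345` serves both routes. -/
theorem uvPhysics345_of_uvEngine345 : UVEngine345 → UVPhysics345 :=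
  fun h G _ _ _ _ _ _ hG r M θ _Δ sch n hθ _hΔ hshape hβ htower htune _hgap hgrowth hconv =>
    h G hG r M θ sch n hθ hshape hβ htower htune hgrowth hconv

end Summit.QuantumFields.YangMills.Cruxes.ContinuumLimitExists.Birth

end
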